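import Literature.NumberTheory.EllipticCurves.SpectralValuationGaloisTransportProofs
import Literature.NumberTheory.EllipticCurves.MinimalModelVariableChangeIntegralProofs
import Literature.NumberTheory.EllipticCurves.GaloisConjugateReductionTypeProofs
import Literature.NumberTheory.EllipticCurves.ZpExtensionEisensteinOrdinaryFiltration
import Literature.NumberTheory.GaloisCohomology.Howard2004.ConjugationDatumOfLifts
import HarnessLib

/-!
# `E₁(K̄_v)` is canonical: the Galois transport of completions carries `E₁(K̄_w)` onto `E₁(K̄_{σw})`, and the adapted lift
# `τ_v` of `σ` carries `Fil_w E[n]` into `Fil_{σw} E[n]` (theorems only; no definition, no named fact, no instance)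

Topic `NumberTheory/EllipticCurves` (cell `pub/bsd-print-x9`, D1 road, Howard 2004 H.4 at `v ∣ p`: the PLACE COMPATIBILITY
hypothesis `hθδ` of `ZpExtensionEisensteinOrdinaryCoreIsotropyProofs` for the canonical conjugation datum
`Howard2004.ConjugationDatum.ofLifts`).

For `E = W ⊗ K` with `W/ℚ`, `σ ∈ Aut(K/ℚ)`, finite places `σ • w = v` and a lift `Θ : K̄_w ≃+* K̄_v` of the Galois transport
`σ_w : K_w ≃+* K_v` (Cassels–Fröhlich VII §1.1): the kernel of reduction `E₁(K̄_w) = localKernelOfReduction w` — the points whose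
`x`-coordinate on the chosen minimal model has `|x|_w > 1` (Silverman VII.2.1–2.2; tree `mem_localKernelOfReduction_iff_of_eq_some`)
— is carried by `Θ` (`localPointsMap W Θ`) into `E₁(K̄_v)`. Ingredients: `Θ` is an isometry of the spectral valuations
(`SpectralValuationGaloisTransportProofs`); `σ_w` transports the chosen minimal model at `w` to A minimal model at `v`
(`isMinimal_map_iff_of_valuation_eq`), which differs from the chosen one by `[u; r, s, t]` with `|u| = 1`, `|r| ≤ 1`
(Silverman VII.1.3(b), `MinimalModelVariableChangeIntegralProofs`), under which the criterion `|x| > 1` is unchanged.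

* `WeierstrassCurve.mem_localKernelOfReduction_some_iff` — `(x, y) ∈ E₁(K̄_w) ↔ |C_w.toX x|_w > 1`, `C_w` the chosen minimising change of variables;
* **`WeierstrassCurve.localPointsMap_mem_localKernelOfReduction`** — `Θ(E₁(K̄_w)) ⊆ E₁(K̄_v)`;
* **`WeierstrassCurve.torsionMap_mem_torsionFilAt_of_liftsCommute`** — for a lift `τ'` of `σ` adapted to `Θ` (`LiftsCommute`),
  `τ' (Fil_w E[n]) ⊆ Fil_v E[n]` (`torsionFilAt`), in particular for `liftAutPlace`;
* **`WeierstrassCurve.torsionMap_delta_smul_mem_torsionFilAt`** — for `cd = ConjugationDatum.ofLifts σ … τ …`: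
  `τ (δ_v • a') ∈ Fil_v E[n]` for `a' ∈ Fil_{σ • v} E[n]` — the hypothesis `hθδ` of `isotropic_ordinaryCore_of_not_dvd_frobeniusTraceAt`
  with `θ = hτ.torsionMap W n`.

References: [SilvermanAEC2009] VII.1 Prop. 1.3(b), VII.2 Props. 2.1–2.2; [CasselsFrohlichANT1967] Ch. VII §1.1;
[SerreGaloisCohomology1997] II.§1.1; [Howard2004HeegnerKolyvagin] §1.3 (arXiv p. 7, L33–48: `v̄ = v^τ`), §3.1 (`Fil_v`).
BSD is not proved by any of this.
-/

noncomputable section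

open scoped NNReal Classical
open NumberField IsDedekindDomain Field

namespace WeierstrassCurve

open Literature.NumberTheory.EllipticCurves Literature.NumberTheory.GaloisRepresentations
  Literature.NumberTheory.Automorphic IsDedekindDomain.HeightOneSpectrum Literature.NumberTheory.GaloisCohomology.Howard2004

universe u

/-! ## §1 `E₁(K̄_w)` in coordinates on the chosen minimal model -/

section Coordinates

variable {K : Type u} [Field K] [NumberField K] (E : WeierstrassCurve K) (w : HeightOneSpectrum (𝓞 K))

/-- **`(x, y) ∈ E₁(K̄_w) ↔ |C_w.toX x|_w > 1`**, `C_w` the chosen change of variables of `E ⊗ K_w` to its local minimal model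
(`localMinimalModel w = C_w • (E ⊗ K_w)`) and `C_w.toX x = u⁻²(x − r)` the `x`-coordinate on it. [cite: SilvermanAEC2009, VII.2 Props. 2.1–2.2] -/
theorem mem_localKernelOfReduction_some_iff (x y : AlgebraicClosure (w.adicCompletion K))
    (hxy : (E.baseChange (AlgebraicClosure (w.adicCompletion K))).toAffine.Nonsingular x y) :
    (show localPoints E (w.adicCompletion K) from .some x y hxy) ∈ E.localKernelOfReduction w ↔
      1 < w.spectralValuation
        ((((E.baseChange (w.adicCompletion K)).exists_isMinimal (w.adicCompletionIntegers K)).choose.map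
          (algebraMap (w.adicCompletion K) (AlgebraicClosure (w.adicCompletion K)))).toX x) := by
  have hQ : E.localPointsEquivModel w (show localPoints E (w.adicCompletion K) from .some x y hxy) =
      .some ((((E.baseChange (w.adicCompletion K)).exists_isMinimal (w.adicCompletionIntegers K)).choose.map
          (algebraMap (w.adicCompletion K) (AlgebraicClosure (w.adicCompletion K)))).toX x)
        ((((E.baseChange (w.adicCompletion K)).exists_isMinimal (w.adicCompletionIntegers K)).choose.map
          (algebraMap (w.adicCompletion K) (AlgebraicClosure (w.adicCompletion K)))).toY x y) ?_ := by
    rw [localPointsEquivModel_apply, localPointsEquivPoint_apply]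
    change Affine.Point.congrEquiv _ (VariableChange.pointEquivBaseChange _ _ _
      (Affine.Point.congrEquiv _ (.some x y hxy))) = _
    rw [Affine.Point.congrEquiv_some, VariableChange.pointEquivBaseChange_some, Affine.Point.congrEquiv_some]
  exact E.mem_localKernelOfReduction_iff_of_eq_some w hQ

end Coordinates

/-! ## §2 Transport of `E₁` along a lift of the Galois transport of completions -/

namespace VariableChange

/-- A ring homomorphism acts on the substituted `x`-coordinate through the coefficients: `f ((C.map g).toX x) =
(C.map (f ∘ g)).toX (f x)`. [cite: SilvermanAEC2009, III.1 Table 3.1] -/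
theorem ringHom_apply_toX_map {F L L' : Type*} [CommRing F] [CommRing L] [CommRing L'] (C : VariableChange F)
    (g : F →+* L) (f : L →+* L') (x : L) : f ((C.map g).toX x) = (C.map (f.comp g)).toX (f x) := by
  simp only [toX_def, VariableChange.map, Units.coe_map_inv, MonoidHom.coe_coe, map_mul, map_pow, map_sub,
    RingHom.coe_comp, Function.comp_apply]

/-- Composition of substitutions on the `x`-coordinate (a `private` copy of the tree's `VariableChange.toX_mul`).
[cite: SilvermanAEC2009, III.1 Table 3.1] -/
private theorem toX_mul_aux' {L : Type*} [Field L] (C C' : VariableChange L) (x : L) :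
    (C * C').toX x = C.toX (C'.toX x) := by
  simp only [toX_def, mul_def, Units.val_mul, Units.val_inv_eq_inv_val]
  have hC' : (C'.u : L) ≠ 0 := C'.u.ne_zero
  field_simp
  ring

end VariableChange

section Transport

variable {K : Type u} [Field K] [NumberField K] (W : WeierstrassCurve ℚ) (σ : K ≃ₐ[ℚ] K)
  {w v : HeightOneSpectrum (𝓞 K)} (h : σ • w = v)
  {Θ : AlgebraicClosure (w.adicCompletion K) ≃+* AlgebraicClosure (v.adicCompletion K)}

/-- `(E ⊗ K_w)^{σ_w} = E ⊗ K_v` for `E = W ⊗ K`, `W/ℚ` (the coefficients are rational). [folklore] -/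
private theorem baseChange_adicCompletion_map_galAdicCompletionEquiv
    [CharZero (w.adicCompletion K)] [CharZero (v.adicCompletion K)] :
    ((W.baseChange K).baseChange (w.adicCompletion K)).map
        (galAdicCompletionEquiv (L := K) σ h : w.adicCompletion K →+* v.adicCompletion K) =
      (W.baseChange K).baseChange (v.adicCompletion K) := by
  rw [baseChange_baseChange_eq W (K := K) (w.adicCompletion K), baseChange_baseChange_eq W (K := K) (v.adicCompletion K)]
  change (W.map (algebraMap ℚ (w.adicCompletion K))).map _ = W.map (algebraMap ℚ (v.adicCompletion K))
  rw [WeierstrassCurve.map_map]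
  exact congrArg W.map (Subsingleton.elim _ _)

/-- For a lift `Θ` of `θ : K_w ≃+* K_v`: `Θ ((C ⊗ K̄_w).toX x) = ((C^θ) ⊗ K̄_v).toX (Θ x)` for a change of variables `C` over `K_w`.
[cite: SilvermanAEC2009, III.1 Table 3.1] -/
theorem lift_apply_toX_map (hΘ : IsLiftOfRingEquiv (galAdicCompletionEquiv (L := K) σ h) Θ)
    (C : VariableChange (w.adicCompletion K)) (x : AlgebraicClosure (w.adicCompletion K)) :
    Θ ((C.map (algebraMap (w.adicCompletion K) (AlgebraicClosure (w.adicCompletion K)))).toX x) =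
      ((C.map (galAdicCompletionEquiv (L := K) σ h : w.adicCompletion K →+* v.adicCompletion K)).map
        (algebraMap (v.adicCompletion K) (AlgebraicClosure (v.adicCompletion K)))).toX (Θ x) := by
  have hcomp : (Θ : AlgebraicClosure (w.adicCompletion K) →+* AlgebraicClosure (v.adicCompletion K)).comp
      (algebraMap (w.adicCompletion K) (AlgebraicClosure (w.adicCompletion K))) =
      (algebraMap (v.adicCompletion K) (AlgebraicClosure (v.adicCompletion K))).comp
        (galAdicCompletionEquiv (L := K) σ h : w.adicCompletion K →+* v.adicCompletion K) :=
    RingHom.ext fun c ↦ hΘ c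
  rw [show Θ ((C.map (algebraMap (w.adicCompletion K) (AlgebraicClosure (w.adicCompletion K)))).toX x) =
      (Θ : AlgebraicClosure (w.adicCompletion K) →+* AlgebraicClosure (v.adicCompletion K)) _ from rfl,
    VariableChange.ringHom_apply_toX_map, VariableChange.map_map, hcomp]
  rfl

/-- **`Θ(E₁(K̄_w)) ⊆ E₁(K̄_v)`**: a lift `Θ : K̄_w ≃+* K̄_v` of the Galois transport `σ_w : K_w ≃+* K_v` (`σ • w = v`) carries the kernel
of reduction of `E = W ⊗ K` at `w` into the one at `v` — `Θ` is an isometry of the spectral valuations, `σ_w` carries the chosen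
minimal model at `w` to a minimal model at `v`, and two minimal models at `v` give the same criterion `|x| > 1` (Silverman VII.1.3(b)).
[cite: SilvermanAEC2009, VII.1 Prop. 1.3(b) and VII.2 Props. 2.1–2.2] [cite: CasselsFrohlichANT1967, Ch. VII §1.1] -/
theorem localPointsMap_mem_localKernelOfReduction [W.IsElliptic] [CharZero (w.adicCompletion K)]
    [CharZero (v.adicCompletion K)] (hΘ : IsLiftOfRingEquiv (galAdicCompletionEquiv (L := K) σ h) Θ)
    {P : localPoints (W.baseChange K) (w.adicCompletion K)} (hP : P ∈ (W.baseChange K).localKernelOfReduction w) :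
    localPointsMap W Θ P ∈ (W.baseChange K).localKernelOfReduction v := by
  set θ := galAdicCompletionEquiv (L := K) σ h with hθ
  -- the chosen minimising changes of variables at `w` and at `v`
  set Cw : VariableChange (w.adicCompletion K) :=
    (((W.baseChange K).baseChange (w.adicCompletion K)).exists_isMinimal (w.adicCompletionIntegers K)).choose with hCw
  set Cv : VariableChange (v.adicCompletion K) :=
    (((W.baseChange K).baseChange (v.adicCompletion K)).exists_isMinimal (v.adicCompletionIntegers K)).choose with hCv
  haveI hminw : (Cw • (W.baseChange K).baseChange (w.adicCompletion K)).IsMinimal (w.adicCompletionIntegers K) :=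
    (((W.baseChange K).baseChange (w.adicCompletion K)).exists_isMinimal (w.adicCompletionIntegers K)).choose_spec
  haveI hminv : (Cv • (W.baseChange K).baseChange (v.adicCompletion K)).IsMinimal (v.adicCompletionIntegers K) :=
    (((W.baseChange K).baseChange (v.adicCompletion K)).exists_isMinimal (v.adicCompletionIntegers K)).choose_spec
  -- the transported minimal model at `v`
  have he : ∀ y, Valued.v (θ y) = Valued.v y := fun y ↦ valued_galAdicCompletionMap K σ h y
  have hVw := valued_le_one_iff_mem_range_adicCompletionIntegers (K := K) w
  have hVv := valued_le_one_iff_mem_range_adicCompletionIntegers (K := K) v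
  haveI hmin1 : ((Cw.map (θ : w.adicCompletion K →+* v.adicCompletion K)) •
      (W.baseChange K).baseChange (v.adicCompletion K)).IsMinimal (v.adicCompletionIntegers K) := by
    have h1 := (isMinimal_map_iff_of_valuation_eq hVw hVv θ he
      (Cw • (W.baseChange K).baseChange (w.adicCompletion K))).mpr hminw
    rwa [← map_variableChange, baseChange_adicCompletion_map_galAdicCompletionEquiv W σ h] at h1
  -- `D = Cv (Cw^θ)⁻¹` has `|u| = 1`, `|r| ≤ 1`, on `K_v` and then on `K̄_v`
  have hΔ : ((W.baseChange K).baseChange (v.adicCompletion K)).Δ ≠ 0 :=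
    ((W.baseChange K).baseChange (v.adicCompletion K)).isUnit_Δ.ne_zero
  obtain ⟨hu, hr⟩ := VariableChange.v_u_eq_one_and_v_r_le_one_of_isMinimal hVv
    ((W.baseChange K).baseChange (v.adicCompletion K)) (Cw.map (θ : w.adicCompletion K →+* v.adicCompletion K)) Cv hΔ
  set D := Cv * (Cw.map (θ : w.adicCompletion K →+* v.adicCompletion K))⁻¹ with hD
  have hsv := coe_spectralValuation v
  have huL : v.spectralValuation
      (((D.map (algebraMap (v.adicCompletion K) (AlgebraicClosure (v.adicCompletion K)))).u :
        AlgebraicClosure (v.adicCompletion K))) = 1 := by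
    rw [VariableChange.map_u, Units.coe_map, MonoidHom.coe_coe]
    apply NNReal.coe_injective
    rw [coe_spectralValuation_algebraMap hsv, NumberField.FinitePlace.norm_def, hu, map_one]
  have hrL : v.spectralValuation
      ((D.map (algebraMap (v.adicCompletion K) (AlgebraicClosure (v.adicCompletion K)))).r) ≤ 1 := by
    rw [VariableChange.map_r, spectralValuation_algebraMap_le_one_iff hsv, mem_adicCompletionIntegers]
    exact hr
  -- the factorisation `Cv = D · Cw^θ`, after base change to `K̄_v`
  have hfac : Cv.map (algebraMap (v.adicCompletion K) (AlgebraicClosure (v.adicCompletion K))) =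
      D.map (algebraMap (v.adicCompletion K) (AlgebraicClosure (v.adicCompletion K))) *
        (Cw.map (θ : w.adicCompletion K →+* v.adicCompletion K)).map
          (algebraMap (v.adicCompletion K) (AlgebraicClosure (v.adicCompletion K))) := by
    have hCvD : Cv = D * Cw.map (θ : w.adicCompletion K →+* v.adicCompletion K) := by rw [hD, inv_mul_cancel_right]
    conv_lhs => rw [hCvD]
    exact (VariableChange.mapHom (algebraMap (v.adicCompletion K) (AlgebraicClosure (v.adicCompletion K)))).map_mul D _
  -- the point
  change ((W.baseChange K).baseChange (AlgebraicClosure (w.adicCompletion K))).toAffine.Point at P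
  rcases P with _ | ⟨x, y, hxy⟩
  · change localPointsMap W Θ (0 : localPoints (W.baseChange K) (w.adicCompletion K)) ∈ _
    rw [map_zero]
    exact AddSubgroup.zero_mem _
  · have hx := ((W.baseChange K).mem_localKernelOfReduction_some_iff w x y hxy).mp hP
    rw [localPointsMap_some W Θ x y hxy]
    refine ((W.baseChange K).mem_localKernelOfReduction_some_iff v (Θ x) (Θ y) _).mpr ?_
    rw [← hCv, hfac, VariableChange.toX_mul_aux', VariableChange.one_lt_v_toX_iff _ huL hrL,
      ← lift_apply_toX_map σ h hΘ, spectralValuation_lift_galAdicCompletionEquiv_eq σ h hΘ]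
    exact hx

/-! ## §3 `Fil_w E[n] ↦ Fil_v E[n]` under an adapted lift of `σ` -/

/-- **A lift `τ'` of `σ` to `K̄` adapted to `Θ` (`Θ ∘ ι_w = ι_v ∘ τ'`, tree `LiftsCommute`) carries `Fil_w E[n] = torsionFilAt w n`
into `Fil_v E[n]`**: `ι_v (τ' a) = Θ (ι_w a)` (`LiftsCommute.localPointsMap_pointsMap`) and `Θ(E₁(K̄_w)) ⊆ E₁(K̄_v)`.
[cite: SilvermanAEC2009, VII.2 Props. 2.1–2.2] [cite: SerreGaloisCohomology1997, II.§1.1] -/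
theorem torsionMap_mem_torsionFilAt_of_liftsCommute [W.IsElliptic] [CharZero (w.adicCompletion K)]
    [CharZero (v.adicCompletion K)] (hΘ : IsLiftOfRingEquiv (galAdicCompletionEquiv (L := K) σ h) Θ)
    {τ' : AlgebraicClosure K ≃+* AlgebraicClosure K} (hτ' : IsLiftOfAut σ τ')
    (hc : LiftsCommute (E := w.adicCompletion K) (E' := v.adicCompletion K) τ' Θ) (n : ℤ)
    {a : geomTorsion (W.baseChange K) n} (ha : a ∈ (W.baseChange K).torsionFilAt w n) :
    hτ'.torsionMap W n a ∈ (W.baseChange K).torsionFilAt v n := by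
  rw [mem_torsionFilAt_iff] at ha ⊢
  have hmem := localPointsMap_mem_localKernelOfReduction W σ h hΘ
    (P := pointsMap (W.baseChange K) (w.adicCompletion K) (a : geomPoints (W.baseChange K))) ha
  rw [hc.localPointsMap_pointsMap W hτ'] at hmem
  exact hmem

/-- The tree's adapted lift `liftAutPlace σ h` carries `Fil_w E[n]` into `Fil_v E[n]` (`σ • w = v`).
[cite: SilvermanAEC2009, VII.2 Props. 2.1–2.2] [cite: CasselsFrohlichANT1967, Ch. VII §1.1] -/
theorem torsionMap_liftAutPlace_mem_torsionFilAt [W.IsElliptic] [CharZero (w.adicCompletion K)]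
    [CharZero (v.adicCompletion K)] (n : ℤ) {a : geomTorsion (W.baseChange K) n}
    (ha : a ∈ (W.baseChange K).torsionFilAt w n) :
    (isLiftOfAut_liftAutPlace σ h).torsionMap W n a ∈ (W.baseChange K).torsionFilAt v n :=
  torsionMap_mem_torsionFilAt_of_liftsCommute W σ h (isLiftOfRingEquiv_ringEquivLift _) (isLiftOfAut_liftAutPlace σ h)
    (liftsCommute_liftAutPlace σ h) n ha

end Transport

/-! ## §4 The place-compatibility hypothesis `hθδ` for `ConjugationDatum.ofLifts` -/

section OfLifts

variable {K : Type} [Field K] [NumberField K] (W : WeierstrassCurve ℚ) [W.IsElliptic] (σ : K ≃ₐ[ℚ] K) (hσ₁ : σ ≠ 1)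
  (hσ : σ * σ = 1) (τ : AlgebraicClosure K ≃+* AlgebraicClosure K) (hτ : IsLiftOfAut σ τ) (hτ₂ : Function.Involutive τ)

/-- **`τ (δ_v a') ∈ Fil_v E[n]` for `a' ∈ Fil_{σ v} E[n]`**, for the canonical conjugation datum `ofLifts` (`δ_v = τ⁻¹ τ_v` with `τ_v` the
lift of `σ` adapted to `K̄_{σv} ≃ K̄_v`, so `τ δ_v = τ_v`): the hypothesis `hθδ` of
`WeierstrassCurve.isotropic_ordinaryCore_of_not_dvd_frobeniusTraceAt` with `θ = hτ.torsionMap W n` (the action of `τ` on `E[n]`).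
[cite: Howard2004HeegnerKolyvagin, §1.3 (arXiv p. 7, L33–48: v̄ = v^τ) and §3.1 (Fil_v)] [cite: SilvermanAEC2009, VII.2 Props. 2.1–2.2] -/
theorem torsionMap_delta_apply_mem_torsionFilAt (v : HeightOneSpectrum (𝓞 K)) [CharZero ((σ • v).adicCompletion K)]
    [CharZero (v.adicCompletion K)] (n : ℤ) {a' : geomTorsion (W.baseChange K) n}
    (ha' : a' ∈ (W.baseChange K).torsionFilAt (σ • v) n) :
    hτ.torsionMap W n ((W.baseChange K).torsionGaloisModule n ((ConjugationDatum.ofLifts σ hσ₁ hσ τ hτ hτ₂).δ v) a') ∈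
      (W.baseChange K).torsionFilAt v n := by
  have h : σ • (σ • v) = v := by rw [smul_smul, hσ, one_smul]
  have key := torsionMap_mem_torsionFilAt_of_liftsCommute W σ h (isLiftOfRingEquiv_ringEquivLift _)
    (ConjugationDatum.isLiftOfAut_tauAt hσ v) (ConjugationDatum.liftsCommute_tauAt hσ v) n ha'
  rw [(ConjugationDatum.isLiftOfAut_tauAt hσ v).torsionMap_eq_comp W hτ n] at key
  exact key

end OfLifts

end WeierstrassCurve

end
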